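import Mathlib
import Literature.NumberTheory.LFunctions.Zhang2022.Section15CU1Euler
import HarnessLib

/-!
# Zhang (2022), Lemma 15.3 (repaired normaliser): the local factor bound
# `𝔲ᴿ₁ⱼ(q,s) = 1 + O(q^{−2σ} + q^{−1−σ})` and the factors at `q ∣ D` — kernel-checked

Topic `Literature/NumberTheory/LFunctions/Zhang2022` (Landau–Siegel audit tree; verdict-neutral).
Y. Zhang, *Discrete mean estimates and the Landau–Siegel zero*, arXiv:2211.02515v1 (2022)
[Zhang2022LandauSiegel] — **an unrefereed manuscript under adjudication; nothing in this file asserts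
or denies its Theorems 1–2.** ZHANG-L discharge lane (WP15), file 6 of the chain towards the leaf
`Typed.Section15C.Lemma153RpI` (rows G-L4t3-1 / G-d52-1). The in-line claim of the Appendix-A
sketch "`𝔲₁ⱼ(q,s) = 1 + O(q^{−2σ})` if `(q,D) = 1`" (p. 105, tex L5176) in the READING that holds
(row D-G-d52-1, disposition of sz-d52: at primes with `χ(q) = −1` there is a genuine first-order term
`≍ q^{−1−σ}`): for the repaired factor `𝔲ᴿ₁ⱼ = Typed.AppendixA2.frakU1FactorR`,

  `‖𝔲ᴿ₁ⱼ(q,s) − 1‖ ≤ |x|² + (M/q)(24|x| + 8|x|²)`, `x = q^{−s}`, `(q, D) = 1`,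

with `M` absolute once `|F_q(1,1;1−βⱼ)| ≥ 1/(2K)` (which follows from `‖𝓜₁(1,1;1−βⱼ)‖ ≥ 1/2` and
the convergence of the other Euler factors, `norm_calM1_le_norm_factor_mul_exp`); and for `q ∣ D`
(`χ(q) = 0`) the factor is exactly `(1 − q^{−s})²`.

What is PROVED here (theorems only; no new definitions, no facts): `norm_tprod_le_exp_tsum`
(`‖∏' f‖ ≤ exp Σ'‖f − 1‖`), `norm_calM1_le_norm_factor_mul_exp` (one factor against the rest),
`frakU1FactorR_sub_one_eq` (the exact decomposition of `𝔲ᴿ − 1`), `norm_frakU1FactorR_sub_one_le`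
(the bound), `frakU1FactorR_eq_of_chi_eq_zero` (`q ∣ D`).

## References

* Y. Zhang, arXiv:2211.02515v1 (2022), App. A p. 105; §15 Lemma 15.3 p. 87.
  [cite: Zhang2022LandauSiegel, App. A p. 105]
-/

noncomputable section

open Complex Real Filter Topology Finset

namespace Literature.NumberTheory.LFunctions.Zhang2022.Lemma153Rp

open Literature.NumberTheory.LFunctions.Zhang2022
open Literature.NumberTheory.LFunctions.Zhang2022.Typed.Section15A
open Literature.NumberTheory.LFunctions.Zhang2022.Typed.Section15B

/-! ## §1. `‖∏' f‖ ≤ exp(Σ' ‖f − 1‖)` and one Euler factor against the rest -/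

/-- **`‖∏'_i f(i)‖ ≤ exp(Σ'_i ‖f(i) − 1‖)`** whenever the right-hand series converges (then the
product converges absolutely; every partial product is bounded by `∏(1 + ‖f−1‖) ≤ exp Σ`).
(elementary step: the size of a convergent Euler product) [cite: Zhang2022LandauSiegel, §15 Lemma 15.3 p. 87] -/
theorem norm_tprod_le_exp_tsum {ι : Type*} {f : ι → ℂ} (hs : Summable fun i => ‖f i - 1‖) :
    ‖∏' i, f i‖ ≤ Real.exp (∑' i, ‖f i - 1‖) := by
  classical
  set g : ι → ℂ := fun i => f i - 1 with hg
  have hfg : f = fun i => 1 + g i := by funext i; simp [hg]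
  have hmult : Multipliable f := by rw [hfg]; exact multipliable_one_add_of_summable hs
  have hP : HasProd f (∏' i, f i) := hmult.hasProd
  have hT : Tendsto (fun A : Finset ι => ∏ i ∈ A, f i) atTop (𝓝 (∏' i, f i)) := hP
  have hbound : ∀ A : Finset ι, ‖∏ i ∈ A, f i‖ ≤ Real.exp (∑' i, ‖f i - 1‖) := by
    intro A
    calc ‖∏ i ∈ A, f i‖ = ∏ i ∈ A, ‖f i‖ := norm_prod _ _
      _ ≤ ∏ i ∈ A, (1 + ‖f i - 1‖) := by
          refine prod_le_prod (fun i _ => norm_nonneg _) fun i _ => ?_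
          calc ‖f i‖ = ‖(f i - 1) + 1‖ := by rw [sub_add_cancel]
            _ ≤ ‖f i - 1‖ + ‖(1 : ℂ)‖ := norm_add_le _ _
            _ = 1 + ‖f i - 1‖ := by rw [norm_one, add_comm]
      _ ≤ ∏ i ∈ A, Real.exp ‖f i - 1‖ :=
          prod_le_prod (fun i _ => by positivity) fun i _ => by
            linarith [Real.add_one_le_exp ‖f i - 1‖]
      _ = Real.exp (∑ i ∈ A, ‖f i - 1‖) := (Real.exp_sum _ _).symm
      _ ≤ Real.exp (∑' i, ‖f i - 1‖) :=
          Real.exp_le_exp.mpr (hs.sum_le_tsum A fun i _ => norm_nonneg _)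
  have hclosed : IsClosed {z : ℂ | ‖z‖ ≤ Real.exp (∑' i, ‖f i - 1‖)} :=
    isClosed_le continuous_norm continuous_const
  exact hclosed.mem_of_tendsto hT (Filter.Eventually.of_forall hbound)

variable (c' : ℝ) {D : ℕ} (χ : DirichletCharacter ℂ D)

/-- **One Euler factor against the rest**: if `Σ_p ‖F_p(1,1;s) − 1‖ < ∞` then for every prime `q`,
`‖𝓜₁(1,1;s)‖ ≤ ‖F_q(1,1;s)‖ · exp(Σ_p ‖F_p(1,1;s) − 1‖)` (`𝓜₁(1,1;s) = F_q · ∏_{p≠q} F_p` and the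
second product has modulus `≤ exp Σ`). [cite: Zhang2022LandauSiegel, §15 Lemma 15.3 p. 87] -/
theorem norm_calM1_le_norm_factor_mul_exp {s : ℂ}
    (hsum : Summable fun p : Nat.Primes => ‖calM1Factor c' χ (p : ℕ) 1 1 s - 1‖) (q : Nat.Primes) :
    ‖calM1 c' χ 1 1 s‖ ≤ ‖calM1Factor c' χ (q : ℕ) 1 1 s‖ *
      Real.exp (∑' p : Nat.Primes, ‖calM1Factor c' χ (p : ℕ) 1 1 s - 1‖) := by
  classical
  set G : Nat.Primes → ℂ := fun p => calM1Factor c' χ (p : ℕ) 1 1 s with hG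
  set G' : Nat.Primes → ℂ := fun p => if p = q then 1 else G p with hG'
  have hle : ∀ p, ‖G' p - 1‖ ≤ ‖G p - 1‖ := by
    intro p
    by_cases hp : p = q
    · simp [hG', hp]
    · simp [hG', hp]
  have hsum' : Summable fun p => ‖G' p - 1‖ :=
    Summable.of_nonneg_of_le (fun _ => norm_nonneg _) hle hsum
  have hupd : Function.update G q 1 = G' := by
    funext p
    by_cases hp : p = q
    · subst hp; simp [hG']
    · rw [Function.update_of_ne hp]; simp [hG', hp]
  have hmult' : Multipliable (Function.update G q 1) := by
    rw [hupd]
    have hfg : G' = fun p => 1 + (G' p - 1) := by funext p; ring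
    rw [hfg]; exact multipliable_one_add_of_summable hsum'
  have hsplit : calM1 c' χ 1 1 s = G q * ∏' p, G' p := by
    have h := Multipliable.tprod_eq_mul_tprod_ite' q hmult'
    unfold calM1
    rw [h]
  have hT : ‖∏' p, G' p‖ ≤ Real.exp (∑' p, ‖G p - 1‖) :=
    (norm_tprod_le_exp_tsum hsum').trans
      (Real.exp_le_exp.mpr (hsum'.tsum_le_tsum hle hsum))
  rw [hsplit, norm_mul]
  exact mul_le_mul_of_nonneg_left hT (norm_nonneg _)

/-! ## §2. The factor bound for `(q, D) = 1` -/

/-- **Exact decomposition of `𝔲ᴿ₁ⱼ(q,s) − 1`**: with `x = q^{−s}`, `w = χ(q)q^{βⱼ}x`,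
`𝔲ᴿ − 1 = −wx + (Q−1)(1−w)²(2x−x²) + (R−1)(1−x)²(2w−w²) + (P−1)wx(3−2x−2w+wx)`
(from `frakU1FactorR_eq_poly`; the `Q = R = P = 1` part of the polynomial is `1 − wx`).
[cite: Zhang2022LandauSiegel, App. A p. 105] -/
theorem frakU1FactorR_sub_one_eq [NeZero D] {q : ℕ} (hq : q.Prime) (hv : χ (q : ZMod D) ^ 2 = 1) (j : ℕ)
    (hmul : Multipliable fun p : Nat.Primes =>
      calM1Factor c' χ (p : ℕ) 1 1 (1 - Skeleton.betaJ c' D j))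
    (hne : calM1 c' χ 1 1 (1 - Skeleton.betaJ c' D j) ≠ 0) {s : ℂ} (hs : 0 < s.re) :
    Typed.AppendixA2.frakU1FactorR c' χ j q s - 1 =
      -(χ (q : ZMod D) * (q : ℂ) ^ Skeleton.betaJ c' D j * (q : ℂ) ^ (-s)) * (q : ℂ) ^ (-s) +
      (calM1Factor c' χ q 1 q (1 - Skeleton.betaJ c' D j) /
            calM1Factor c' χ q 1 1 (1 - Skeleton.betaJ c' D j) - 1) *
          ((1 - χ (q : ZMod D) * (q : ℂ) ^ Skeleton.betaJ c' D j * (q : ℂ) ^ (-s)) ^ 2 *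
            (2 * (q : ℂ) ^ (-s) - ((q : ℂ) ^ (-s)) ^ 2)) +
      (lam1 c' χ q 1 * calM1Factor c' χ q q 1 (1 - Skeleton.betaJ c' D j) /
            calM1Factor c' χ q 1 1 (1 - Skeleton.betaJ c' D j) - 1) *
          ((1 - (q : ℂ) ^ (-s)) ^ 2 *
            (2 * (χ (q : ZMod D) * (q : ℂ) ^ Skeleton.betaJ c' D j * (q : ℂ) ^ (-s)) -
              (χ (q : ZMod D) * (q : ℂ) ^ Skeleton.betaJ c' D j * (q : ℂ) ^ (-s)) ^ 2)) +
      (lam1 c' χ q 1 * calM1Factor c' χ q q q (1 - Skeleton.betaJ c' D j) /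
            calM1Factor c' χ q 1 1 (1 - Skeleton.betaJ c' D j) - 1) *
          ((χ (q : ZMod D) * (q : ℂ) ^ Skeleton.betaJ c' D j * (q : ℂ) ^ (-s)) * (q : ℂ) ^ (-s) *
            (3 - 2 * (q : ℂ) ^ (-s) - 2 * (χ (q : ZMod D) * (q : ℂ) ^ Skeleton.betaJ c' D j * (q : ℂ) ^ (-s)) +
              (χ (q : ZMod D) * (q : ℂ) ^ Skeleton.betaJ c' D j * (q : ℂ) ^ (-s)) * (q : ℂ) ^ (-s))) := by
  rw [frakU1FactorR_eq_poly c' χ hq hv j hmul hne hs]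
  ring

/-- For `‖x‖ ≤ 1`, `‖w‖ ≤ ‖x‖`: the polynomial weights of the decomposition are bounded by
`12‖x‖`, `12‖x‖` and `8‖x‖²`. [folklore] -/
private theorem poly_weight_bounds {x w : ℂ} (hx : ‖x‖ ≤ 1) (hw : ‖w‖ ≤ ‖x‖) :
    ‖(1 - w) ^ 2 * (2 * x - x ^ 2)‖ ≤ 12 * ‖x‖ ∧ ‖(1 - x) ^ 2 * (2 * w - w ^ 2)‖ ≤ 12 * ‖x‖ ∧
      ‖w * x * (3 - 2 * x - 2 * w + w * x)‖ ≤ 8 * ‖x‖ ^ 2 := by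
  have hx0 : 0 ≤ ‖x‖ := norm_nonneg _
  have hw1 : ‖w‖ ≤ 1 := hw.trans hx
  have h1w : ‖1 - w‖ ≤ 2 := by
    calc ‖1 - w‖ ≤ ‖(1 : ℂ)‖ + ‖w‖ := norm_sub_le _ _
      _ ≤ 1 + 1 := by rw [norm_one]; gcongr
      _ = 2 := by norm_num
  have h1x : ‖1 - x‖ ≤ 2 := by
    calc ‖1 - x‖ ≤ ‖(1 : ℂ)‖ + ‖x‖ := norm_sub_le _ _
      _ ≤ 1 + 1 := by rw [norm_one]; gcongr
      _ = 2 := by norm_num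
  have h2x : ‖2 * x - x ^ 2‖ ≤ 3 * ‖x‖ := by
    calc ‖2 * x - x ^ 2‖ ≤ ‖2 * x‖ + ‖x ^ 2‖ := norm_sub_le _ _
      _ = 2 * ‖x‖ + ‖x‖ * ‖x‖ := by rw [norm_mul, norm_pow, sq]; simp
      _ ≤ 2 * ‖x‖ + 1 * ‖x‖ := by gcongr
      _ = 3 * ‖x‖ := by ring
  have h2w : ‖2 * w - w ^ 2‖ ≤ 3 * ‖x‖ := by
    calc ‖2 * w - w ^ 2‖ ≤ ‖2 * w‖ + ‖w ^ 2‖ := norm_sub_le _ _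
      _ = 2 * ‖w‖ + ‖w‖ * ‖w‖ := by rw [norm_mul, norm_pow, sq]; simp
      _ ≤ 2 * ‖x‖ + 1 * ‖x‖ := by gcongr
      _ = 3 * ‖x‖ := by ring
  have h3 : ‖3 - 2 * x - 2 * w + w * x‖ ≤ 8 := by
    calc ‖3 - 2 * x - 2 * w + w * x‖ ≤ ‖3 - 2 * x - 2 * w‖ + ‖w * x‖ := norm_add_le _ _
      _ ≤ ‖(3 : ℂ) - 2 * x‖ + ‖2 * w‖ + ‖w * x‖ := by gcongr; exact norm_sub_le _ _
      _ ≤ (‖(3 : ℂ)‖ + ‖2 * x‖) + ‖2 * w‖ + ‖w * x‖ := by gcongr; exact norm_sub_le _ _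
      _ = 3 + 2 * ‖x‖ + 2 * ‖w‖ + ‖w‖ * ‖x‖ := by simp
      _ ≤ 3 + 2 * 1 + 2 * 1 + 1 * 1 := by gcongr
      _ = 8 := by norm_num
  refine ⟨?_, ?_, ?_⟩
  · rw [norm_mul, norm_pow]
    calc ‖1 - w‖ ^ 2 * ‖2 * x - x ^ 2‖ ≤ 2 ^ 2 * (3 * ‖x‖) :=
          mul_le_mul (pow_le_pow_left₀ (norm_nonneg _) h1w 2) h2x (norm_nonneg _) (by positivity)
      _ = 12 * ‖x‖ := by ring
  · rw [norm_mul, norm_pow]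
    calc ‖1 - x‖ ^ 2 * ‖2 * w - w ^ 2‖ ≤ 2 ^ 2 * (3 * ‖x‖) :=
          mul_le_mul (pow_le_pow_left₀ (norm_nonneg _) h1x 2) h2w (norm_nonneg _) (by positivity)
      _ = 12 * ‖x‖ := by ring
  · rw [norm_mul, norm_mul]
    calc ‖w‖ * ‖x‖ * ‖3 - 2 * x - 2 * w + w * x‖ ≤ ‖x‖ * ‖x‖ * 8 :=
          mul_le_mul (mul_le_mul_of_nonneg_right hw hx0) h3 (norm_nonneg _) (by positivity)
      _ = 8 * ‖x‖ ^ 2 := by ring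

/-- **The factor bound for `(q,D) = 1`** (row D-G-d52-1's reading): if `‖F_q(1,1;1−βⱼ)‖⁻¹ ≤ 2K`
then, with `x = q^{−s}` (`Re s > 0`), `Z₂ = Σ(m+1)²2^{−m}`, `W = Σ(m+2)²2^{−m}`,
`‖𝔲ᴿ₁ⱼ(q,s) − 1‖ ≤ ‖x‖² + (2K(90Z₂ + 72 + 45W²)/q)·(24‖x‖ + 8‖x‖²)`.
[cite: Zhang2022LandauSiegel, App. A p. 105] -/
theorem norm_frakU1FactorR_sub_one_le [NeZero D] {q : ℕ} (hq : q.Prime) (hv : χ (q : ZMod D) ^ 2 = 1)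
    (j : ℕ) (hmul : Multipliable fun p : Nat.Primes =>
      calM1Factor c' χ (p : ℕ) 1 1 (1 - Skeleton.betaJ c' D j))
    (hne : calM1 c' χ 1 1 (1 - Skeleton.betaJ c' D j) ≠ 0) {K : ℝ}
    (hK : ‖calM1Factor c' χ q 1 1 (1 - Skeleton.betaJ c' D j)‖⁻¹ ≤ 2 * K) {s : ℂ} (hs : 0 < s.re) :
    ‖Typed.AppendixA2.frakU1FactorR c' χ j q s - 1‖ ≤
      ‖(q : ℂ) ^ (-s)‖ ^ 2 +
        2 * K * (90 * (∑' m : ℕ, ((m : ℝ) + 1) ^ 2 * (1 / 2 : ℝ) ^ m) + 72 +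
            45 * (∑' m : ℕ, ((m : ℝ) + 2) ^ 2 * (1 / 2 : ℝ) ^ m) ^ 2) / q *
          (24 * ‖(q : ℂ) ^ (-s)‖ + 8 * ‖(q : ℂ) ^ (-s)‖ ^ 2) := by
  set s₀ : ℂ := 1 - Skeleton.betaJ c' D j with hs₀
  set x : ℂ := (q : ℂ) ^ (-s) with hx
  set t : ℂ := (q : ℂ) ^ Skeleton.betaJ c' D j with ht
  set v : ℂ := χ (q : ZMod D) with hvdef
  set w : ℂ := v * t * x with hw
  set Z₂ : ℝ := ∑' m : ℕ, ((m : ℝ) + 1) ^ 2 * (1 / 2 : ℝ) ^ m with hZ₂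
  set W : ℝ := ∑' m : ℕ, ((m : ℝ) + 2) ^ 2 * (1 / 2 : ℝ) ^ m with hW
  set F00 : ℂ := calM1Factor c' χ q 1 1 s₀ with hF00
  have hZ₂0 : 0 ≤ Z₂ := tsum_nonneg fun m => by positivity
  have hW0 : 0 ≤ W := tsum_nonneg fun m => by positivity
  have hq0 : (0 : ℝ) < q := by exact_mod_cast hq.pos
  have hs₀re : s₀.re = 1 := by rw [hs₀, one_sub_betaJ_re]
  have hs₀pos : 0 < s₀.re := by rw [hs₀re]; norm_num
  have hF0 : F00 ≠ 0 := calM1Factor_ne_zero_of_calM1_ne_zero c' χ hmul hne ⟨q, hq⟩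
  have hF0n : 0 < ‖F00‖ := norm_pos_iff.mpr hF0
  have hK0 : 0 ≤ 2 * K := le_trans (inv_nonneg.mpr hF0n.le) hK
  -- sizes of `x`, `w`
  have hxn : ‖x‖ < 1 := by
    rw [hx, Complex.norm_natCast_cpow_of_pos hq.pos, Complex.neg_re]
    exact Real.rpow_lt_one_of_one_lt_of_neg (by exact_mod_cast hq.one_lt) (by linarith)
  have hwx : ‖w‖ ≤ ‖x‖ := by
    rw [hw, norm_mul, norm_mul, ht, norm_cpow_betaJ c' hq j, mul_one]
    calc ‖v‖ * ‖x‖ ≤ 1 * ‖x‖ := by gcongr; exact χ.norm_le_one _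
      _ = ‖x‖ := one_mul _
  obtain ⟨hb1, hb2, hb3⟩ := poly_weight_bounds hxn.le hwx
  -- the three ratios minus one
  have hA₁ := norm_calM1Factor_one_prime_sub_le c' χ hq hs₀re
  have hA₂ := norm_lam_mul_calM1Factor_prime_one_sub_le c' χ hq hs₀re
  have hQ : ‖calM1Factor c' χ q 1 q s₀ / F00 - 1‖ ≤ 2 * K * (90 * Z₂ / q) := by
    rw [div_sub_one hF0, norm_div, div_eq_mul_inv, mul_comm]
    exact mul_le_mul hK hA₁ (norm_nonneg _) hK0
  have hR : ‖lam1 c' χ q 1 * calM1Factor c' χ q q 1 s₀ / F00 - 1‖ ≤ 2 * K * ((72 + 45 * W ^ 2) / q) := by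
    rw [div_sub_one hF0, norm_div, div_eq_mul_inv, mul_comm]
    exact mul_le_mul hK hA₂ (norm_nonneg _) hK0
  have hP : ‖lam1 c' χ q 1 * calM1Factor c' χ q q q s₀ / F00 - 1‖ ≤
      2 * K * (90 * Z₂ / q) + 2 * K * ((72 + 45 * W ^ 2) / q) := by
    rw [div_sub_one hF0, lam_mul_calM1Factor_prime_prime_sub c' χ hq hs₀pos, norm_div, div_eq_mul_inv,
      mul_comm]
    calc ‖F00‖⁻¹ * ‖(calM1Factor c' χ q 1 q s₀ - F00) + (lam1 c' χ q 1 * calM1Factor c' χ q q 1 s₀ - F00)‖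
        ≤ (2 * K) * (90 * Z₂ / q + (72 + 45 * W ^ 2) / q) :=
          mul_le_mul hK ((norm_add_le _ _).trans (add_le_add hA₁ hA₂)) (norm_nonneg _) hK0
      _ = _ := by ring
  -- assemble
  rw [frakU1FactorR_sub_one_eq c' χ hq hv j hmul hne hs]
  simp only [← hx, ← ht, ← hvdef, ← hs₀, ← hF00]
  have hwx' : ‖-(v * t * x) * x‖ ≤ ‖x‖ ^ 2 := by
    rw [norm_mul, norm_neg, ← hw, sq]; exact mul_le_mul_of_nonneg_right hwx (norm_nonneg _)
  have hx0 : 0 ≤ ‖x‖ := norm_nonneg _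
  set M : ℝ := 2 * K * (90 * Z₂ + 72 + 45 * W ^ 2) / q with hM
  have hMeq : 2 * K * (90 * Z₂ / q) + 2 * K * ((72 + 45 * W ^ 2) / q) = M := by rw [hM]; ring
  have hM0 : 0 ≤ M := by rw [hM]; positivity
  have hQM : ‖calM1Factor c' χ q 1 q s₀ / F00 - 1‖ ≤ M := hQ.trans (by
    rw [← hMeq]; have : 0 ≤ 2 * K * ((72 + 45 * W ^ 2) / q) := by positivity
    linarith)
  have hRM : ‖lam1 c' χ q 1 * calM1Factor c' χ q q 1 s₀ / F00 - 1‖ ≤ M := hR.trans (by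
    rw [← hMeq]; have : 0 ≤ 2 * K * (90 * Z₂ / q) := by positivity
    linarith)
  have hPM : ‖lam1 c' χ q 1 * calM1Factor c' χ q q q s₀ / F00 - 1‖ ≤ M := hP.trans (le_of_eq hMeq)
  rw [← hw]
  have hb : ‖(calM1Factor c' χ q 1 q s₀ / F00 - 1) * ((1 - w) ^ 2 * (2 * x - x ^ 2))‖ ≤
      M * (12 * ‖x‖) := by
    rw [norm_mul]; exact mul_le_mul hQM hb1 (norm_nonneg _) hM0
  have hc : ‖(lam1 c' χ q 1 * calM1Factor c' χ q q 1 s₀ / F00 - 1) * ((1 - x) ^ 2 * (2 * w - w ^ 2))‖ ≤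
      M * (12 * ‖x‖) := by
    rw [norm_mul]; exact mul_le_mul hRM hb2 (norm_nonneg _) hM0
  have hd : ‖(lam1 c' χ q 1 * calM1Factor c' χ q q q s₀ / F00 - 1) *
      (w * x * (3 - 2 * x - 2 * w + w * x))‖ ≤ M * (8 * ‖x‖ ^ 2) := by
    rw [norm_mul]; exact mul_le_mul hPM hb3 (norm_nonneg _) hM0
  calc _ ≤ ‖-(v * t * x) * x‖ + ‖(calM1Factor c' χ q 1 q s₀ / F00 - 1) * ((1 - w) ^ 2 * (2 * x - x ^ 2))‖ +
        ‖(lam1 c' χ q 1 * calM1Factor c' χ q q 1 s₀ / F00 - 1) * ((1 - x) ^ 2 * (2 * w - w ^ 2))‖ +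
        ‖(lam1 c' χ q 1 * calM1Factor c' χ q q q s₀ / F00 - 1) * (w * x * (3 - 2 * x - 2 * w + w * x))‖ := by
        refine (norm_add_le _ _).trans (add_le_add ((norm_add_le _ _).trans (add_le_add
          ((norm_add_le _ _).trans (add_le_add le_rfl le_rfl)) le_rfl)) le_rfl)
    _ ≤ ‖x‖ ^ 2 + M * (12 * ‖x‖) + M * (12 * ‖x‖) + M * (8 * ‖x‖ ^ 2) :=
        add_le_add (add_le_add (add_le_add hwx' hb) hc) hd
    _ = ‖x‖ ^ 2 + M * (24 * ‖x‖ + 8 * ‖x‖ ^ 2) := by ring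

/-! ## §3. The factors at the primes `q ∣ D` -/

/-- **For `χ(q) = 0` (i.e. `q ∣ D`): `𝔲ᴿ₁ⱼ(q,s) = (1 − q^{−s})²`** — only the term `r = 0` of the
local series survives, and it is `ϖ₁ⱼ(1) = 1` (cell RULING 15e: the `q ∣ D` factors of `𝒰₁ⱼ`).
[cite: Zhang2022LandauSiegel, §15 Lemma 15.3 p. 87] -/
theorem frakU1FactorR_eq_of_chi_eq_zero [NeZero D] {q : ℕ} (hχ : χ (q : ZMod D) = 0)
    (j : ℕ) (h1 : varpi1 c' χ j 1 = 1) (s : ℂ) :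
    Typed.AppendixA2.frakU1FactorR c' χ j q s = (1 - (q : ℂ) ^ (-s)) ^ 2 := by
  unfold Typed.AppendixA2.frakU1FactorR
  rw [hχ, zero_mul, sub_zero, one_pow, mul_one]
  have hts : ∑' r : ℕ, χ ((q ^ r : ℕ) : ZMod D) * (((q ^ r).divisors.card : ℕ) : ℂ) *
      varpi1 c' χ j (q ^ r) / (q : ℂ) ^ ((r : ℂ) * s) = 1 := by
    rw [tsum_eq_single 0]
    · simp [h1]
    · intro r hr
      rw [chi_prime_pow, hχ, zero_pow hr]
      simp
  rw [hts, mul_one]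

end Literature.NumberTheory.LFunctions.Zhang2022.Lemma153Rp
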